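import Summits.QuantumFields.YangMills.Theorems.AllWindowsColdBoxBulkMidSandwichLocalisedOffCore

/-!
# Two-level (core / off-core) pointwise lemmas under the sandwich: localised defect, localised Hessian
# integral, localised Brascamp–Lieb
# (crux idea `logconcave-core-extension` on ⟨stmt-QuantumFields-24006⟩ — toward a LOCALISED quadratic
# covariance comparison at the core constant `r_K`)

Whitened frame, `A ∈ C²(ℝⁿ)` with the GLOBAL second-difference sandwich `(1 ± δ)|h|²` (`δ < 1`) and, on a
measurable set `K` (the core), the TIGHTER Hessian pinching `(1 ± δ_K)|v|² ` (`δ_K ≤ δ`); `Z = ∫e^{−A}`,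
`P = ∫_{Kᶜ} e^{−A}` (so `∫_K e^{−A} = Z − P`).

* `defect_sq_le_of_abs_hess` : POINTWISE defect bound — if `|D²A(x)(v,v) − |v|²| ≤ r|v|²` for all `v` then
  `|D²A(x)(·,u) − u|² ≤ r²|u|²` (discriminant argument of the tree's `defect_sq_le`, with the pinching
  constant read off AT THE POINT `x`);
* `integral_hess_affine_le_localised` : `∫ D²A(u,u) e^{−A} ≤ (1+δ_K)∫|u|²e^{−A} + (δ−δ_K)∫_{Kᶜ}|u|²e^{−A}`
  for an affine field `u = Mx + m`;
* `bl_raw_localised` : Brascamp–Lieb with a two-level gradient bound —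
  `Var·Z ≤ ((1−δ_K)⁻¹ c_K (Z − P) + (1−δ)⁻¹ c P)·Z` when `|∇h|² ≤ c_K` on `K` and `≤ c` everywhere
  (the tree's PROVED pointwise `Literature.Probability.Distributions.bl_wholeSpace_raw`);
* `integral_sq_dotProduct_le_localised`, `integral_mulVec_sq_le_localised` : the centred row bounds
  `∫(w·x)²e^{−A} ≤ |w|²((1−δ_K)⁻¹(Z−P) + (1−δ)⁻¹P)`, `∫|Hx|²e^{−A} ≤ tr(H²)(…)`.

HONEST SCOPE.  Free-hands work of the LEAD seat of ⟨stmt-QuantumFields-24006⟩ (FCL lineage) on an ingredient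
of an UN-TRIAGED crux idea card; classical log-concave probability.  No stub of LINE-18, no crux, rung or
summit is proved; the Yang–Mills mass gap is NOT proved by any of this.
-/

noncomputable section

namespace Summit.QuantumFields.YangMills.Theorems.SandwichVariancePinching

open MeasureTheory Real Filter Topology Set
open Literature.Probability.Distributions (coordGradient coordHessian bl_wholeSpace_raw continuous_blQuad)
open Summit.QuantumFields.YangMills.Cruxes.TransportCovarianceTransfer (trace_mul_self_of_isSymm)

variable {n : ℕ}

/-! ## §1 The pointwise defect with the local pinching constant -/

/-- **POINTWISE DEFECT BOUND**: if the symmetric form `D²A(x) − 1` has all diagonal values in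
`[−r|v|², r|v|²]` then `s_j := D²A(x)(e_j,u) − u_j` satisfies `|s|² ≤ r²|u|²` (operator norm `≤ r` by the
discriminant argument). [folklore] -/
theorem defect_sq_le_of_abs_hess {A : (Fin n → ℝ) → ℝ} (hA : ContDiff ℝ 2 A) {r : ℝ} (x u : Fin n → ℝ)
    (hdiag : ∀ v : Fin n → ℝ, |fderiv ℝ (fderiv ℝ A) x v v - v ⬝ᵥ v| ≤ r * (v ⬝ᵥ v)) :
    (fun j => fderiv ℝ (fderiv ℝ A) x (Pi.single j 1) u - u j) ⬝ᵥ
        (fun j => fderiv ℝ (fderiv ℝ A) x (Pi.single j 1) u - u j) ≤ r ^ 2 * (u ⬝ᵥ u) := by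
  set B := fderiv ℝ (fderiv ℝ A) x with hB
  set s : Fin n → ℝ := fun j => B (Pi.single j 1) u - u j with hs
  have hsymm : ∀ z w, B z w = B w z := fderiv_fderiv_symm hA x
  have hDz : ∀ z, B z u - z ⬝ᵥ u = s ⬝ᵥ z := by
    intro z
    rw [show B z u = B.flip u z from (B.flip_apply z u).symm, clm_apply_eq_sum_single (B.flip u) z]
    simp only [ContinuousLinearMap.flip_apply, hs, dotProduct, sub_mul, Finset.sum_sub_distrib]
    congr 1
    · exact Finset.sum_congr rfl fun j _ => by ring
    · exact Finset.sum_congr rfl fun j _ => by ring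
  have hpol : ∀ (z : Fin n → ℝ) (t : ℝ),
      t * (s ⬝ᵥ z) ≤ r / 2 * (t ^ 2 * (z ⬝ᵥ z) + u ⬝ᵥ u) ∧
      -(t * (s ⬝ᵥ z)) ≤ r / 2 * (t ^ 2 * (z ⬝ᵥ z) + u ⬝ᵥ u) := by
    intro z t
    have e : t * (s ⬝ᵥ z) = B (t • z) u - (t • z) ⬝ᵥ u := by
      rw [hDz (t • z), dotProduct_smul, smul_eq_mul]
    have h1 := hdiag (t • z + u)
    have h2 := hdiag (t • z - u)
    have epol : B (t • z) u - (t • z) ⬝ᵥ u =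
        ((B (t • z + u) (t • z + u) - (t • z + u) ⬝ᵥ (t • z + u)) -
          (B (t • z - u) (t • z - u) - (t • z - u) ⬝ᵥ (t • z - u))) / 4 := by
      simp only [map_add, map_sub, add_apply, sub_apply,
        add_dotProduct, dotProduct_add, sub_dotProduct, dotProduct_sub, hsymm u (t • z), dotProduct_comm u (t • z)]
      ring
    have hn1 : (t • z + u) ⬝ᵥ (t • z + u) + (t • z - u) ⬝ᵥ (t • z - u) =
        2 * (t ^ 2 * (z ⬝ᵥ z) + u ⬝ᵥ u) := by
      simp only [add_dotProduct, dotProduct_add, sub_dotProduct, dotProduct_sub, smul_dotProduct,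
        dotProduct_smul, smul_eq_mul, dotProduct_comm u z]
      ring
    have hrn : r * ((t • z + u) ⬝ᵥ (t • z + u)) + r * ((t • z - u) ⬝ᵥ (t • z - u)) =
        2 * (r * (t ^ 2 * (z ⬝ᵥ z) + u ⬝ᵥ u)) := by rw [← mul_add, hn1]; ring
    rw [e, epol]
    rw [abs_le] at h1 h2
    constructor <;> linarith [h1.1, h1.2, h2.1, h2.2, hrn]
  have hss : 0 ≤ s ⬝ᵥ s := by simpa using dotProduct_self_star_nonneg s
  have hquad : ∀ t : ℝ, 0 ≤ r / 2 * (s ⬝ᵥ s) * (t * t) + (-(s ⬝ᵥ s)) * t + r / 2 * (u ⬝ᵥ u) := by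
    intro t
    have := (hpol s t).1
    nlinarith
  have hdisc := discrim_le_zero hquad
  rw [discrim] at hdisc
  have h4 : (s ⬝ᵥ s) * (s ⬝ᵥ s) ≤ (s ⬝ᵥ s) * (r ^ 2 * (u ⬝ᵥ u)) := by nlinarith
  rcases hss.lt_or_eq with hpos | hzero
  · exact le_of_mul_le_mul_left h4 hpos
  · rw [← hzero]
    have huu : 0 ≤ u ⬝ᵥ u := by simpa using dotProduct_self_star_nonneg u
    positivity

/-- The global sandwich gives the diagonal Hessian pinching `|D²A(x)(v,v) − |v|²| ≤ δ|v|²` at every point.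
[folklore] -/
theorem abs_hess_sub_self_le {A : (Fin n → ℝ) → ℝ} (hA : ContDiff ℝ 2 A) {δ : ℝ}
    (hsw : ∀ x h : Fin n → ℝ, (1 - δ) * (h ⬝ᵥ h) ≤ A (x + h) + A (x - h) - 2 * A x ∧
      A (x + h) + A (x - h) - 2 * A x ≤ (1 + δ) * (h ⬝ᵥ h)) (x v : Fin n → ℝ) :
    |fderiv ℝ (fderiv ℝ A) x v v - v ⬝ᵥ v| ≤ δ * (v ⬝ᵥ v) := by
  have hup := fderiv_fderiv_le_of_secondDiff_le hA (fun y h => (hsw y h).2) x v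
  have hlo := le_fderiv_fderiv_of_le_secondDiff hA (fun y h => (hsw y h).1) x v
  rw [abs_le]; constructor <;> nlinarith

/-- A two-sided local pinching `(1−r)|v|² ≤ D²A(x)(v,v) ≤ (1+r)|v|²` in diagonal form. [folklore] -/
theorem abs_hess_sub_self_le_of_pinch {A : (Fin n → ℝ) → ℝ} {r : ℝ} {x : Fin n → ℝ}
    (h : ∀ v : Fin n → ℝ, (1 - r) * (v ⬝ᵥ v) ≤ fderiv ℝ (fderiv ℝ A) x v v ∧
      fderiv ℝ (fderiv ℝ A) x v v ≤ (1 + r) * (v ⬝ᵥ v)) (v : Fin n → ℝ) :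
    |fderiv ℝ (fderiv ℝ A) x v v - v ⬝ᵥ v| ≤ r * (v ⬝ᵥ v) := by
  have h1 := h v
  rw [abs_le]; constructor <;> nlinarith [h1.1, h1.2]

/-! ## §2 The Hessian integral along an affine field, localised -/

/-- **LOCALISED HESSIAN INTEGRAL**: for `u = Mx + m`,
`∫ D²A(u,u) e^{−A} ≤ (1+δ_K)·∫|u|²e^{−A} + (δ−δ_K)·∫_{Kᶜ}|u|²e^{−A}`. [folklore] -/
theorem integral_hess_affine_le_localised {A : (Fin n → ℝ) → ℝ} (hA : ContDiff ℝ 2 A) {δ : ℝ}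
    (hδ : 0 ≤ δ) (hδ1 : δ < 1)
    (hsw : ∀ x h : Fin n → ℝ, (1 - δ) * (h ⬝ᵥ h) ≤ A (x + h) + A (x - h) - 2 * A x ∧
      A (x + h) + A (x - h) - 2 * A x ≤ (1 + δ) * (h ⬝ᵥ h))
    {K : Set (Fin n → ℝ)} (hK : MeasurableSet K) {δK : ℝ}
    (hloc : ∀ x ∈ K, ∀ v : Fin n → ℝ, fderiv ℝ (fderiv ℝ A) x v v ≤ (1 + δK) * (v ⬝ᵥ v))
    (M : Matrix (Fin n) (Fin n) ℝ) (m : Fin n → ℝ) :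
    ∫ x, fderiv ℝ (fderiv ℝ A) x (M.mulVec x + m) (M.mulVec x + m) * exp (-A x) ≤
      (1 + δK) * (∫ x, ((M.mulVec x + m) ⬝ᵥ (M.mulVec x + m)) * exp (-A x)) +
        (δ - δK) * ∫ x in Kᶜ, ((M.mulVec x + m) ⬝ᵥ (M.mulVec x + m)) * exp (-A x) := by
  have hAc : Continuous A := hA.continuous
  obtain ⟨C₀, κ, _, hκ, hlb⟩ := exists_quadratic_lower_of_sandwich hAc hδ1 hsw
  obtain ⟨Cu, hCu0, hCu⟩ := exists_norm_affine_le M m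
  have hn : (0:ℝ) ≤ n := Nat.cast_nonneg n
  have huub : ∀ x, ‖M.mulVec x + m‖ ^ 2 ≤ Cu ^ 2 * (1 + ‖x‖) ^ 2 := fun x => by
    rw [← mul_pow]; exact pow_le_pow_left₀ (norm_nonneg _) (hCu x) 2
  have huu0 : ∀ x, 0 ≤ (M.mulVec x + m) ⬝ᵥ (M.mulVec x + m) := fun x => by
    simpa using dotProduct_self_star_nonneg (M.mulVec x + m)
  have hIuu : Integrable fun x => ((M.mulVec x + m) ⬝ᵥ (M.mulVec x + m)) * exp (-A x) := by
    refine integrable_mul_exp_neg_of_growth hAc (((contDiff_affine M m).continuous).dotProduct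
      (contDiff_affine M m).continuous) hκ (by norm_num : 2 ≤ 8) hlb (D := (n : ℝ) * Cu ^ 2) fun x => ?_
    rw [abs_of_nonneg (huu0 x)]
    nlinarith [dotProduct_self_le_card_mul_norm_sq (M.mulVec x + m), mul_le_mul_of_nonneg_left (huub x) hn]
  have hIhess : Integrable fun x =>
      fderiv ℝ (fderiv ℝ A) x (M.mulVec x + m) (M.mulVec x + m) * exp (-A x) := by
    refine integrable_mul_exp_neg_of_growth hAc
      (continuous_fderiv_fderiv_apply_of_contDiff hA (contDiff_affine M m).continuous
        (contDiff_affine M m).continuous) hκ (by norm_num : 2 ≤ 8) hlb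
      (D := (1 + δ) / 2 * ((n : ℝ) * Cu ^ 2 + (n : ℝ) * Cu ^ 2)) fun x => ?_
    have h := abs_fderiv_fderiv_le_norm hA hsw hδ x (M.mulVec x + m) (M.mulVec x + m)
    have hb := mul_le_mul_of_nonneg_left (huub x) hn
    have hd : 0 ≤ (1 + δ) / 2 := by positivity
    calc |fderiv ℝ (fderiv ℝ A) x (M.mulVec x + m) (M.mulVec x + m)|
        ≤ (1 + δ) / 2 * ((n : ℝ) * ‖M.mulVec x + m‖ ^ 2 + (n : ℝ) * ‖M.mulVec x + m‖ ^ 2) := h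
      _ ≤ (1 + δ) / 2 * ((n : ℝ) * (Cu ^ 2 * (1 + ‖x‖) ^ 2) + (n : ℝ) * (Cu ^ 2 * (1 + ‖x‖) ^ 2)) :=
          mul_le_mul_of_nonneg_left (add_le_add hb hb) hd
      _ = (1 + δ) / 2 * ((n : ℝ) * Cu ^ 2 + (n : ℝ) * Cu ^ 2) * (1 + ‖x‖) ^ 2 := by ring
  -- the dominating two-level weight
  set g : (Fin n → ℝ) → ℝ := fun x => (1 + δK) * (((M.mulVec x + m) ⬝ᵥ (M.mulVec x + m)) * exp (-A x)) +
    (δ - δK) * Kᶜ.indicator (fun x => ((M.mulVec x + m) ⬝ᵥ (M.mulVec x + m)) * exp (-A x)) x with hg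
  have hgI : Integrable g := (hIuu.const_mul _).add ((hIuu.indicator hK.compl).const_mul _)
  have hpt : ∀ x, fderiv ℝ (fderiv ℝ A) x (M.mulVec x + m) (M.mulVec x + m) * exp (-A x) ≤ g x := by
    intro x
    have he : 0 ≤ exp (-A x) := (exp_pos _).le
    have hq := huu0 x
    by_cases hx : x ∈ K
    · have h1 := hloc x hx (M.mulVec x + m)
      have hxc : x ∉ Kᶜ := fun h => h hx
      simp only [hg, indicator_of_notMem hxc, mul_zero, add_zero]
      nlinarith [mul_le_mul_of_nonneg_right h1 he]
    · have h1 := fderiv_fderiv_le_of_secondDiff_le hA (fun y h => (hsw y h).2) x (M.mulVec x + m)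
      have hxc : x ∈ Kᶜ := hx
      simp only [hg, indicator_of_mem hxc]
      nlinarith [mul_le_mul_of_nonneg_right h1 he]
  calc ∫ x, fderiv ℝ (fderiv ℝ A) x (M.mulVec x + m) (M.mulVec x + m) * exp (-A x)
      ≤ ∫ x, g x := integral_mono hIhess hgI hpt
    _ = (1 + δK) * (∫ x, ((M.mulVec x + m) ⬝ᵥ (M.mulVec x + m)) * exp (-A x)) +
        (δ - δK) * ∫ x in Kᶜ, ((M.mulVec x + m) ⬝ᵥ (M.mulVec x + m)) * exp (-A x) := by
        simp only [hg]
        rw [integral_add (hIuu.const_mul _) ((hIuu.indicator hK.compl).const_mul _), integral_const_mul,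
          integral_const_mul, integral_indicator hK.compl]

/-! ## §3 Brascamp–Lieb with a two-level gradient bound -/

/-- **LOCALISED BRASCAMP–LIEB** (whitened frame, `A ∈ C²`): with the global sandwich (`δ < 1`), a local
Hessian floor `(1−δ_K)|v|² ≤ D²A(x)(v,v)` on a measurable `K` (`δ_K < 1`), and a `C¹` observable `h` of
cubic growth whose squared gradient is `≤ c_K` on `K` and `≤ c` everywhere,
`(∫ h²e^{−A})Z − (∫ h e^{−A})² ≤ ((1−δ_K)⁻¹ c_K (Z − ∫_{Kᶜ}e^{−A}) + (1−δ)⁻¹ c ∫_{Kᶜ}e^{−A})·Z`.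
[cite: BrascampLieb1976, Thm 4.1 — via the tree's `bl_wholeSpace_raw`] -/
theorem bl_raw_localised {A : (Fin n → ℝ) → ℝ} (hA : ContDiff ℝ 2 A) {δ : ℝ} (hδ1 : δ < 1)
    (hsw : ∀ x h : Fin n → ℝ, (1 - δ) * (h ⬝ᵥ h) ≤ A (x + h) + A (x - h) - 2 * A x ∧
      A (x + h) + A (x - h) - 2 * A x ≤ (1 + δ) * (h ⬝ᵥ h))
    {K : Set (Fin n → ℝ)} (hK : MeasurableSet K) {δK : ℝ} (hδK1 : δK < 1)
    (hloc : ∀ x ∈ K, ∀ v : Fin n → ℝ, (1 - δK) * (v ⬝ᵥ v) ≤ fderiv ℝ (fderiv ℝ A) x v v)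
    {h : (Fin n → ℝ) → ℝ} (hh : ContDiff ℝ 1 h) {Dh : ℝ}
    (hhb : ∀ x, |h x| ≤ Dh * (1 + ‖x‖) ^ 3)
    {cK c : ℝ} (hcK : 0 ≤ cK) (hc : 0 ≤ c)
    (hgK : ∀ x ∈ K, coordGradient h x ⬝ᵥ coordGradient h x ≤ cK)
    (hg : ∀ x, coordGradient h x ⬝ᵥ coordGradient h x ≤ c) :
    (∫ x, h x ^ 2 * exp (-A x)) * (∫ x, exp (-A x)) - (∫ x, h x * exp (-A x)) ^ 2 ≤
      ((1 - δK)⁻¹ * cK * ((∫ x, exp (-A x)) - ∫ x in Kᶜ, exp (-A x)) +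
        (1 - δ)⁻¹ * c * ∫ x in Kᶜ, exp (-A x)) * ∫ x, exp (-A x) := by
  have hAc : Continuous A := hA.continuous
  obtain ⟨C₀, κ, _, hκ, hlb⟩ := exists_quadratic_lower_of_sandwich hAc hδ1 hsw
  have hpd := posDef_coordHessian hA hδ1 hsw
  have hZ : Integrable fun x => exp (-A x) := by
    have := integrable_mul_exp_neg_of_growth hAc continuous_const hκ (by norm_num : 0 ≤ 8) hlb
      (w := fun _ => (1:ℝ)) (D := 1) (fun x => by simp)
    simpa using this
  have hI1 : Integrable fun x => h x * exp (-A x) :=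
    integrable_mul_exp_neg_of_growth hAc hh.continuous hκ (by norm_num) hlb hhb
  have hI2 : Integrable fun x => h x ^ 2 * exp (-A x) := by
    have := abs_mul_le_growth hhb hhb
    refine integrable_mul_exp_neg_of_growth hAc (hh.continuous.pow 2) hκ (by norm_num : 3 + 3 ≤ 8) hlb
      (D := Dh * Dh) (fun x => ?_)
    rw [sq]; exact this x
  -- the dominating weight
  set c₁ : ℝ := (1 - δK)⁻¹ * cK with hc₁
  set c₀ : ℝ := (1 - δ)⁻¹ * c with hc₀
  have hc₁0 : 0 ≤ c₁ := mul_nonneg (inv_nonneg.mpr (by linarith)) hcK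
  have hc₀0 : 0 ≤ c₀ := mul_nonneg (inv_nonneg.mpr (by linarith)) hc
  set g : (Fin n → ℝ) → ℝ := fun x =>
    c₁ * K.indicator (fun x => exp (-A x)) x + c₀ * Kᶜ.indicator (fun x => exp (-A x)) x with hgdef
  have hgi : Integrable g := ((hZ.indicator hK).const_mul _).add ((hZ.indicator hK.compl).const_mul _)
  have hQle : ∀ x, coordGradient h x ⬝ᵥ (coordHessian A x)⁻¹.mulVec (coordGradient h x) * exp (-A x) ≤ g x := by
    intro x
    have hd : DifferentiableAt ℝ (fderiv ℝ A) x :=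
      ((hA.fderiv_right (m := 1) (by norm_num)).differentiable (by norm_num)) x
    have he := (exp_pos (-A x)).le
    have hgg : 0 ≤ coordGradient h x ⬝ᵥ coordGradient h x := by
      simpa using dotProduct_self_star_nonneg (coordGradient h x)
    by_cases hx : x ∈ K
    · have hq : coordGradient h x ⬝ᵥ (coordHessian A x)⁻¹.mulVec (coordGradient h x) ≤
          (1 - δK)⁻¹ * (coordGradient h x ⬝ᵥ coordGradient h x) := by
        refine inv_quadForm_le (hpd x) (by linarith) (fun w => ?_) _
        rw [Literature.Probability.Distributions.dotProduct_coordHessian_mulVec hd]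
        exact hloc x hx w
      have hxc : x ∉ Kᶜ := fun h' => h' hx
      simp only [hgdef, indicator_of_mem hx, indicator_of_notMem hxc, mul_zero, add_zero]
      have h2 : (1 - δK)⁻¹ * (coordGradient h x ⬝ᵥ coordGradient h x) ≤ c₁ :=
        mul_le_mul_of_nonneg_left (hgK x hx) (inv_nonneg.mpr (by linarith))
      nlinarith
    · have hq : coordGradient h x ⬝ᵥ (coordHessian A x)⁻¹.mulVec (coordGradient h x) ≤
          (1 - δ)⁻¹ * (coordGradient h x ⬝ᵥ coordGradient h x) := blQuad_le_of_sandwich hA hδ1 hsw h x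
      have hxc : x ∈ Kᶜ := hx
      simp only [hgdef, indicator_of_notMem hx, indicator_of_mem hxc, mul_zero, zero_add]
      have h2 : (1 - δ)⁻¹ * (coordGradient h x ⬝ᵥ coordGradient h x) ≤ c₀ :=
        mul_le_mul_of_nonneg_left (hg x) (inv_nonneg.mpr (by linarith))
      nlinarith
  have hQc := continuous_blQuad hA hpd hh
  have hQ0 := fun x => Literature.Probability.Distributions.blQuad_nonneg (h := h) hpd x
  have hIQ : Integrable fun x => coordGradient h x ⬝ᵥ (coordHessian A x)⁻¹.mulVec (coordGradient h x) *
      exp (-A x) := by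
    refine hgi.mono' ((hQc.mul (continuous_exp.comp hAc.neg)).aestronglyMeasurable) (ae_of_all _ fun x => ?_)
    rw [Real.norm_eq_abs, abs_of_nonneg (mul_nonneg (hQ0 x) (exp_pos _).le)]
    exact hQle x
  have hraw := bl_wholeSpace_raw hA hpd hh hZ hI1 hI2 hIQ
  have hmono : ∫ x, coordGradient h x ⬝ᵥ (coordHessian A x)⁻¹.mulVec (coordGradient h x) * exp (-A x) ≤
      ∫ x, g x := integral_mono hIQ hgi hQle
  have hKint : ∫ x in K, exp (-A x) = (∫ x, exp (-A x)) - ∫ x in Kᶜ, exp (-A x) := by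
    have := integral_add_compl hK hZ
    linarith
  have hgint : ∫ x, g x = c₁ * ((∫ x, exp (-A x)) - ∫ x in Kᶜ, exp (-A x)) + c₀ * ∫ x in Kᶜ, exp (-A x) := by
    simp only [hgdef]
    rw [integral_add ((hZ.indicator hK).const_mul _) ((hZ.indicator hK.compl).const_mul _),
      integral_const_mul, integral_const_mul, integral_indicator hK, integral_indicator hK.compl, hKint]
  have hZ0 : 0 ≤ ∫ x, exp (-A x) := integral_nonneg fun x => (exp_pos _).le
  calc (∫ x, h x ^ 2 * exp (-A x)) * (∫ x, exp (-A x)) - (∫ x, h x * exp (-A x)) ^ 2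
      ≤ (∫ x, coordGradient h x ⬝ᵥ (coordHessian A x)⁻¹.mulVec (coordGradient h x) * exp (-A x)) *
          ∫ x, exp (-A x) := hraw
    _ ≤ (∫ x, g x) * ∫ x, exp (-A x) := mul_le_mul_of_nonneg_right hmono hZ0
    _ = ((1 - δK)⁻¹ * cK * ((∫ x, exp (-A x)) - ∫ x in Kᶜ, exp (-A x)) +
        (1 - δ)⁻¹ * c * ∫ x in Kᶜ, exp (-A x)) * ∫ x, exp (-A x) := by rw [hgint]

/-! ## §4 Row Brascamp–Lieb, localised -/

/-- **LOCALISED ROW BRASCAMP–LIEB** (centred): `∫ (w·x)² e^{−A} ≤ |w|²((1−δ_K)⁻¹(Z − P) + (1−δ)⁻¹P)`,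
`P = ∫_{Kᶜ}e^{−A}`. [folklore] -/
theorem integral_sq_dotProduct_le_localised {A : (Fin n → ℝ) → ℝ} (hA : ContDiff ℝ 2 A) {δ : ℝ}
    (hδ1 : δ < 1)
    (hsw : ∀ x h : Fin n → ℝ, (1 - δ) * (h ⬝ᵥ h) ≤ A (x + h) + A (x - h) - 2 * A x ∧
      A (x + h) + A (x - h) - 2 * A x ≤ (1 + δ) * (h ⬝ᵥ h))
    (hcent : ∀ i : Fin n, ∫ x, x i * exp (-A x) = 0)
    {K : Set (Fin n → ℝ)} (hK : MeasurableSet K) {δK : ℝ} (hδK1 : δK < 1)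
    (hloc : ∀ x ∈ K, ∀ v : Fin n → ℝ, (1 - δK) * (v ⬝ᵥ v) ≤ fderiv ℝ (fderiv ℝ A) x v v)
    (w : Fin n → ℝ) :
    ∫ x, (w ⬝ᵥ x) ^ 2 * exp (-A x) ≤
      (w ⬝ᵥ w) * ((1 - δK)⁻¹ * ((∫ x, exp (-A x)) - ∫ x in Kᶜ, exp (-A x)) +
        (1 - δ)⁻¹ * ∫ x in Kᶜ, exp (-A x)) := by
  have hAc : Continuous A := hA.continuous
  obtain ⟨C₀, κ, _, hκ, hlb⟩ := exists_quadratic_lower_of_sandwich hAc hδ1 hsw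
  have hZint : Integrable fun x => exp (-A x) := by
    have := integrable_mul_exp_neg_of_growth hAc continuous_const hκ (by norm_num : 0 ≤ 8) hlb
      (w := fun _ => (1:ℝ)) (D := 1) (fun x => by simp)
    simpa using this
  have hZ : 0 < ∫ x, exp (-A x) := integral_exp_pos hZint
  have hbl := bl_linear_localised hA hδ1 hsw w hK hδK1 hloc
  have e1 : (fun x : Fin n → ℝ => (x ⬝ᵥ w) ^ 2 * exp (-A x)) = fun x => (w ⬝ᵥ x) ^ 2 * exp (-A x) := by
    funext x; rw [dotProduct_comm]
  have e2 : (fun x : Fin n → ℝ => (x ⬝ᵥ w) * exp (-A x)) = fun x => (w ⬝ᵥ x) * exp (-A x) := by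
    funext x; rw [dotProduct_comm]
  rw [e1, e2, integral_dotProduct_mul_exp_neg_eq_zero hAc hδ1 hsw hcent w] at hbl
  have hKint : ∫ x in K, exp (-A x) = (∫ x, exp (-A x)) - ∫ x in Kᶜ, exp (-A x) := by
    have := integral_add_compl hK hZint
    linarith
  rw [hKint] at hbl
  have : (∫ x, (w ⬝ᵥ x) ^ 2 * exp (-A x)) * (∫ x, exp (-A x)) ≤
      ((w ⬝ᵥ w) * ((1 - δK)⁻¹ * ((∫ x, exp (-A x)) - ∫ x in Kᶜ, exp (-A x)) +
        (1 - δ)⁻¹ * ∫ x in Kᶜ, exp (-A x))) * ∫ x, exp (-A x) := by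
    have e3 : (∫ x, exp (-A x)) - ((∫ x, exp (-A x)) - ∫ x in Kᶜ, exp (-A x)) = ∫ x in Kᶜ, exp (-A x) := by
      ring
    rw [e3] at hbl
    nlinarith [hbl]
  exact le_of_mul_le_mul_right this hZ

/-- **LOCALISED ROW BRASCAMP–LIEB, summed**: `∫ |Hx|² e^{−A} ≤ tr(H²)((1−δ_K)⁻¹(Z − P) + (1−δ)⁻¹P)`
(`H` symmetric). [folklore] -/
theorem integral_mulVec_sq_le_localised {A : (Fin n → ℝ) → ℝ} (hA : ContDiff ℝ 2 A) {δ : ℝ}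
    (hδ1 : δ < 1)
    (hsw : ∀ x h : Fin n → ℝ, (1 - δ) * (h ⬝ᵥ h) ≤ A (x + h) + A (x - h) - 2 * A x ∧
      A (x + h) + A (x - h) - 2 * A x ≤ (1 + δ) * (h ⬝ᵥ h))
    (hcent : ∀ i : Fin n, ∫ x, x i * exp (-A x) = 0)
    {K : Set (Fin n → ℝ)} (hK : MeasurableSet K) {δK : ℝ} (hδK1 : δK < 1)
    (hloc : ∀ x ∈ K, ∀ v : Fin n → ℝ, (1 - δK) * (v ⬝ᵥ v) ≤ fderiv ℝ (fderiv ℝ A) x v v)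
    {H : Matrix (Fin n) (Fin n) ℝ} (hH : H.IsSymm) :
    ∫ x, (H.mulVec x ⬝ᵥ H.mulVec x) * exp (-A x) ≤
      (H * H).trace * ((1 - δK)⁻¹ * ((∫ x, exp (-A x)) - ∫ x in Kᶜ, exp (-A x)) +
        (1 - δ)⁻¹ * ∫ x in Kᶜ, exp (-A x)) := by
  have hAc : Continuous A := hA.continuous
  obtain ⟨C₀, κ, _, hκ, hlb⟩ := exists_quadratic_lower_of_sandwich hAc hδ1 hsw
  have hτ : (H * H).trace = ∑ i, H i ⬝ᵥ H i := by
    rw [trace_mul_self_of_isSymm hH]; simp [dotProduct, sq]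
  have hS2sum : ∫ x, (H.mulVec x ⬝ᵥ H.mulVec x) * exp (-A x) = ∑ i, ∫ x, (H i ⬝ᵥ x) ^ 2 * exp (-A x) := by
    rw [← integral_finsetSum]
    · congr 1; funext x
      rw [← Finset.sum_mul]
      congr 1
      simp [dotProduct, Matrix.mulVec, sq]
    · intro i _
      have hb := abs_mul_le_growth (abs_dotProduct_le_growth (H i)) (abs_dotProduct_le_growth (H i))
      refine integrable_mul_exp_neg_of_growth hAc ((continuous_const.dotProduct continuous_id).pow 2)
        hκ (by norm_num : 1 + 1 ≤ 8) hlb (D := (∑ j, |H i j|) * (∑ j, |H i j|)) (fun x => ?_)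
      rw [sq]; exact hb x
  rw [hS2sum, hτ, Finset.sum_mul]
  exact Finset.sum_le_sum fun i _ => integral_sq_dotProduct_le_localised hA hδ1 hsw hcent hK hδK1 hloc (H i)

end Summit.QuantumFields.YangMills.Theorems.SandwichVariancePinching

end
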